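import Literature.GroupTheory.CombinatorialGroupTheory.CoveringSystem
import Literature.GroupTheory.CombinatorialGroupTheory.SchreierTreeBFS
import HarnessLib

/-!
# Contracting a spanning tree of the covering: the contracted system has one vertex

Topic `Literature/GroupTheory/CombinatorialGroupTheory`; continues `CoveringSystem.lean` and
`SchreierTreeBFS.lean`.  The covering system of a one-vertex word `R₀` over a transitive action
on `A` has one vertex over each point of `A` (`sameCycle_sysPerm_faces_iff`).  Deleting the
letters of the `|A| - 1` edges of the breadth-first Schreier tree from all faces contracts the
tree, and the contracted system has ONE vertex (ZVC 3.1.6 (b), 4.14.22 proof: "the Euler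
characteristic is unchanged when a tree is contracted").  Proof: by `sameCycle_sysPerm_filter` the
new vertex permutation is the first return of `σ ∘ s_T` (`s_T` = `bar` on the tree letters), and
`σ ∘ s_T = σ ∘ ∏_{a ≠ a₀} (u_a ū_a)` is built one tree edge at a time in order of increasing
distance from the base point; each new transposition joins the class of the new vertex `a` to the
class containing `parent a` (`sameCycle_mul_swap_iff`), so in the end all classes are one.

* `sameCycle_mul_swap_iff` — cycles of `ρ ∘ (u v)` for `u`, `v` in different cycles of `ρ`;
* `treeLetter`, `IsTreeLetterOf`, `treePerm` — the tree letters and the product of their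
  transpositions; `ContractInv`, `contractInv_snoc`, `bfsOrder`, `sameCycle_contract_all` — the
  contraction invariant along the breadth-first order: after all tree transpositions the twisted
  vertex permutation `σ ∘ ∏ (u_a ū_a)` is transitive.  (The contracted SYSTEM is treated in
  `TreeContractionFaces.lean`.)

## References

* H. Zieschang, E. Vogt, H.-D. Coldewey, *Surfaces and Planar Discontinuous Groups*, LNM 835,
  Springer 1980, 3.1.6, 4.14.22. [ZieschangVogtColdewey1980]
-/

namespace Literature.GroupTheory.CombinatorialGroupTheory

open List Equiv Equiv.Perm

/-! ### Cycles of `ρ ∘ (u v)` -/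

section Swap

variable {α : Type*} [Finite α] [DecidableEq α]

/-- **Cycles after one transposition of points in different cycles**: `x`, `z` are in one cycle
of `ρ ∘ (u v)` iff they are in one cycle of `ρ`, or both lie in the union of the cycles of `u`
and `v` (which merge). [cite: ZieschangVogtColdewey1980, 3.1.6] -/
theorem sameCycle_mul_swap_iff {ρ : Perm α} {u v : α} (hnot : ¬ ρ.SameCycle u v) (x z : α) :
    (ρ * swap u v).SameCycle x z ↔
      ρ.SameCycle x z ∨ ((ρ.SameCycle u x ∨ ρ.SameCycle v x) ∧ (ρ.SameCycle u z ∨ ρ.SameCycle v z)) := by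
  set τ := ρ * swap u v with hτ
  have huv : u ≠ v := fun h => hnot (h ▸ SameCycle.rfl)
  have hτu : τ u = ρ v := by rw [hτ, Perm.mul_apply, swap_apply_left]
  have hτv : τ v = ρ u := by rw [hτ, Perm.mul_apply, swap_apply_right]
  have hτo : ∀ y, y ≠ u → y ≠ v → τ y = ρ y := fun y h1 h2 => by
    rw [hτ, Perm.mul_apply, swap_apply_of_ne_of_ne h1 h2]
  -- the merged set
  set M : Set α := {y | ρ.SameCycle u y ∨ ρ.SameCycle v y} with hM
  have hmerge : ∀ y ∈ M, τ.SameCycle u y := fun y hy => sameCycle_of_swap_merge hτu hτv hτo hnot hy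
  have hMτ : ∀ y ∈ M, τ y ∈ M := by
    intro y hy
    by_cases h1 : y = u
    · subst h1; rw [hτu]; exact Or.inr ((sameCycle_apply_right (f := ρ)).2 SameCycle.rfl)
    by_cases h2 : y = v
    · subst h2; rw [hτv]; exact Or.inl ((sameCycle_apply_right (f := ρ)).2 SameCycle.rfl)
    rw [hτo y h1 h2]
    rcases hy with hy | hy
    · exact Or.inl ((sameCycle_apply_right (f := ρ)).2 hy)
    · exact Or.inr ((sameCycle_apply_right (f := ρ)).2 hy)
  have hMρ : ∀ y ∈ M, ρ y ∈ M := by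
    rintro y (hy | hy)
    · exact Or.inl ((sameCycle_apply_right (f := ρ)).2 hy)
    · exact Or.inr ((sameCycle_apply_right (f := ρ)).2 hy)
  -- outside `M` the two permutations have the same cycles
  have hout : ∀ y, y ∉ M → ∀ w ∈ {w | ρ.SameCycle y w}, τ w = ρ w := by
    intro y hy w hw
    refine hτo w (fun h => hy ?_) (fun h => hy ?_)
    · subst h; exact Or.inl hw.symm
    · subst h; exact Or.inr hw.symm
  have hstab : ∀ y, ∀ w ∈ {w | ρ.SameCycle y w}, ρ w ∈ {w | ρ.SameCycle y w} :=
    fun y w hw => (sameCycle_apply_right (f := ρ)).2 hw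
  constructor
  · intro h
    by_cases hx : x ∈ M
    · exact Or.inr ⟨hx, SameCycle.mem_of_forall_apply_mem hMτ hx h⟩
    · left
      have hstabτ : ∀ w ∈ {w | ρ.SameCycle x w}, τ w ∈ {w | ρ.SameCycle x w} := fun w hw => by
        rw [hout x hx w hw]; exact hstab x w hw
      exact SameCycle.mem_of_forall_apply_mem hstabτ SameCycle.rfl h
  · rintro (h | ⟨hx, hz⟩)
    · by_cases hx : x ∈ M
      · have hz : z ∈ M := SameCycle.mem_of_forall_apply_mem hMρ hx h
        exact (hmerge x hx).symm.trans (hmerge z hz)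
      · exact SameCycle.of_forall_apply_eq (hstab x) (fun w hw => (hout x hx w hw).symm) SameCycle.rfl h
    · exact (hmerge x hx).symm.trans (hmerge z hz)

end Swap

/-! ### The tree letters of the breadth-first tree -/

namespace CoveringPresentation

universe u v

variable {X : Type u} {A : Type v} {act : FreeGroup X →* Equiv.Perm A} {a₀ : A}
  (htr : IsTransitiveFrom act a₀)

/-- The non-base vertices. [cite: ZieschangVogtColdewey1980, 2.2.2] -/
abbrev NonBase (a₀ : A) : Type v := {a : A // a ≠ a₀}

/-- The forward letter of the tree edge of a non-base vertex. [cite: ZieschangVogtColdewey1980, 3.1.6] -/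
noncomputable def treeLetter (p : NonBase a₀) : (X × A) × Bool := (arrow htr p.2, true)

/-- The transposition exchanging the two letters of the tree edge of `p`.
[cite: ZieschangVogtColdewey1980, 3.1.6] -/
noncomputable def treeSwap [DecidableEq X] [DecidableEq A] (p : NonBase a₀) : Perm ((X × A) × Bool) :=
  swap (treeLetter htr p) (bar (treeLetter htr p))

/-- The product of the tree transpositions over a list of non-base vertices.
[cite: ZieschangVogtColdewey1980, 3.1.6] -/
noncomputable def treePerm [DecidableEq X] [DecidableEq A] (ps : List (NonBase a₀)) : Perm ((X × A) × Bool) :=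
  (ps.map (treeSwap htr)).prod

/-- A letter is a tree letter of one of the listed vertices. [cite: ZieschangVogtColdewey1980, 3.1.6] -/
def IsTreeLetterOf (ps : List (NonBase a₀)) (l : (X × A) × Bool) : Prop := ∃ p ∈ ps, l.1 = arrow htr p.2

open Classical in
/-- **The product of the tree transpositions is `bar` on the tree letters and the identity
elsewhere** (the tree edges are pairwise distinct). [cite: ZieschangVogtColdewey1980, 3.1.6] -/
theorem treePerm_apply [DecidableEq X] [DecidableEq A] :
    ∀ (ps : List (NonBase a₀)) (_ : ps.Nodup) (l : (X × A) × Bool),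
      treePerm htr ps l = if IsTreeLetterOf htr ps l then bar l else l
  | [], _, l => by simp [treePerm, IsTreeLetterOf]
  | p :: ps, hd, l => by
    have hp : p ∉ ps := (nodup_cons.1 hd).1
    have ih := treePerm_apply ps (nodup_cons.1 hd).2 l
    rw [treePerm, map_cons, prod_cons, Perm.mul_apply, ← treePerm, ih]
    by_cases hl : l.1 = arrow htr p.2
    · -- `l` is one of the two letters of `p`'s edge; no later vertex has this edge
      have hnot : ¬ IsTreeLetterOf htr ps l := by
        rintro ⟨q, hq, hq'⟩
        exact hp (by rwa [Subtype.ext (arrow_injective htr p.2 q.2 (hl.symm.trans hq'))])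
      have hyes : IsTreeLetterOf htr (p :: ps) l := ⟨p, mem_cons_self, hl⟩
      rw [if_neg hnot, if_pos hyes, treeSwap]
      obtain ⟨e, _ | _⟩ := l
      · have : ((e, false) : (X × A) × Bool) = bar (treeLetter htr p) := by
          simp only [treeLetter, bar_mk, ← hl]; rfl
        rw [this, swap_apply_right, bar_bar]
      · have : ((e, true) : (X × A) × Bool) = treeLetter htr p := by
          simp only [treeLetter, ← hl]
        rw [this, swap_apply_left]
    · have hiff : IsTreeLetterOf htr (p :: ps) l ↔ IsTreeLetterOf htr ps l := by
        constructor
        · rintro ⟨q, hq, hq'⟩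
          rcases mem_cons.1 hq with rfl | hq
          · exact absurd hq' hl
          · exact ⟨q, hq, hq'⟩
        · rintro ⟨q, hq, hq'⟩; exact ⟨q, mem_cons_of_mem _ hq, hq'⟩
      have hfix : ∀ m : (X × A) × Bool, m.1 = l.1 → treeSwap htr p m = m := by
        intro m hm
        rw [treeSwap, swap_apply_of_ne_of_ne]
        · intro h; exact hl (by rw [← hm, h]; rfl)
        · intro h; exact hl (by rw [← hm, h]; rfl)
      by_cases h : IsTreeLetterOf htr ps l
      · rw [if_pos h, if_pos (hiff.2 h), hfix (bar l) rfl]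
      · rw [if_neg h, if_neg (fun h' => h (hiff.1 h')), hfix l rfl]

/-- The two letters of the tree edge of `p` end at `p` and at `parent p` (in some order).
[cite: ZieschangVogtColdewey1980, 3.1.6] -/
theorem fin_treeLetter_or (p : NonBase a₀) :
    (fin act (treeLetter htr p) = p.1 ∧ fin act (bar (treeLetter htr p)) = parent htr p.1) ∨
      (fin act (treeLetter htr p) = parent htr p.1 ∧ fin act (bar (treeLetter htr p)) = p.1) := by
  rcases ends_arrow htr p.2 with ⟨h2, hact, -⟩ | ⟨h2, hact, -⟩
  · left
    refine ⟨?_, ?_⟩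
    · simp only [treeLetter, fin]; exact hact
    · simp only [treeLetter, bar_mk, fin]; exact h2
  · right
    refine ⟨?_, ?_⟩
    · simp only [treeLetter, fin]; exact hact
    · simp only [treeLetter, bar_mk, fin]; exact h2

/-! ### Contracting the tree edges in breadth-first order -/

section Contract

variable [Fintype A] [DecidableEq A] [Fintype X] [DecidableEq X] {R₀ : List (X × Bool)}
  (hR : R₀.Nodup) (hall : ∀ β : X × Bool, β ∈ R₀) (htriv : act (FreeGroup.mk R₀) = 1)
  (hV : VertexTransitive R₀)

/-- The vertices already contracted into the base vertex after processing `ps`.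
[cite: ZieschangVogtColdewey1980, 3.1.6] -/
def Done (ps : List (NonBase a₀)) (b : A) : Prop := b = a₀ ∨ ∃ p ∈ ps, p.1 = b

omit [Fintype A] [DecidableEq A] [Fintype X] [DecidableEq X] htr in
/-- `Done` grows along the list. [cite: ZieschangVogtColdewey1980, 3.1.6] -/
theorem done_append_iff (ps : List (NonBase a₀)) (p : NonBase a₀) (b : A) :
    Done (ps ++ [p]) b ↔ Done ps b ∨ b = p.1 := by
  simp only [Done, mem_append, mem_singleton]
  constructor
  · rintro (h | ⟨q, hq | rfl, hqb⟩)
    · exact Or.inl (Or.inl h)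
    · exact Or.inl (Or.inr ⟨q, hq, hqb⟩)
    · exact Or.inr hqb.symm
  · rintro ((h | ⟨q, hq, hqb⟩) | rfl)
    · exact Or.inl h
    · exact Or.inr ⟨q, Or.inl hq, hqb⟩
    · exact Or.inr ⟨p, Or.inr rfl, rfl⟩

/-- **The contraction invariant**: after contracting the tree edges of the vertices in `ps`, two
letters lie in one cycle of `σ ∘ ∏_{p ∈ ps} (u_p ū_p)` iff they end at the same vertex or both
end at contracted vertices. [cite: ZieschangVogtColdewey1980, 3.1.6] -/
def ContractInv (R₀ : List (X × Bool)) (ps : List (NonBase a₀)) : Prop :=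
  ∀ l l' : (X × A) × Bool, (sysPerm (faces act R₀) * treePerm htr ps).SameCycle l l' ↔
    (fin act l = fin act l' ∨ (Done ps (fin act l) ∧ Done ps (fin act l')))

include hR hall htriv hV in
/-- Before any contraction the cycles are the fibres of `fin`. [cite: ZieschangVogtColdewey1980, 3.1.6] -/
theorem contractInv_nil : ContractInv htr R₀ [] := by
  intro l l'
  rw [treePerm, map_nil, prod_nil, mul_one, sameCycle_sysPerm_faces_iff act hR hall htriv hV]
  simp only [Done, not_mem_nil, false_and, exists_false, or_false]
  constructor
  · exact Or.inl
  · rintro (h | ⟨h1, h2⟩)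
    · exact h
    · rw [h1, h2]

/-- **One contraction step**: contracting the tree edge of a new vertex `p` whose parent is
already contracted merges the class of `p` into the class of the base vertex.
[cite: ZieschangVogtColdewey1980, 3.1.6] -/
theorem contractInv_snoc {ps : List (NonBase a₀)} {p : NonBase a₀} (hI : ContractInv htr R₀ ps)
    (hp : p ∉ ps) (hpar : Done ps (parent htr p.1)) : ContractInv htr R₀ (ps ++ [p]) := by
  set ρ := sysPerm (faces act R₀) * treePerm htr ps with hρ
  set u := treeLetter htr p with hu
  have hτ : sysPerm (faces act R₀) * treePerm htr (ps ++ [p]) = ρ * swap u (bar u) := by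
    rw [hρ, treePerm, map_append, prod_append, map_singleton, prod_singleton, mul_assoc]; rfl
  -- `p` itself is not yet contracted, its parent is
  have hnp : ¬ Done ps p.1 := by
    rintro (h | ⟨q, hq, hqp⟩)
    · exact p.2 h
    · exact hp (by rwa [← Subtype.ext hqp])
  have hne : p.1 ≠ parent htr p.1 := fun h => by
    have := dist_parent_lt htr p.2; rw [← h] at this; exact lt_irrefl _ this
  -- the merged class: letters ending at a contracted vertex or at `p`
  have hM : ∀ l, (ρ.SameCycle u l ∨ ρ.SameCycle (bar u) l) ↔ (Done ps (fin act l) ∨ fin act l = p.1) := by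
    intro l
    rw [hI, hI]
    rcases fin_treeLetter_or htr p with ⟨h1, h2⟩ | ⟨h1, h2⟩ <;> rw [h1, h2]
    · constructor
      · rintro ((h | ⟨h', _⟩) | (h | ⟨_, h'⟩))
        · exact Or.inr h.symm
        · exact absurd h' hnp
        · exact Or.inl (h ▸ hpar)
        · exact Or.inl h'
      · rintro (h | h)
        · exact Or.inr (Or.inr ⟨hpar, h⟩)
        · exact Or.inl (Or.inl h.symm)
    · constructor
      · rintro ((h | ⟨_, h'⟩) | (h | ⟨h', _⟩))
        · exact Or.inl (h ▸ hpar)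
        · exact Or.inl h'
        · exact Or.inr h.symm
        · exact absurd h' hnp
      · rintro (h | h)
        · exact Or.inl (Or.inr ⟨hpar, h⟩)
        · exact Or.inr (Or.inl h.symm)
  have hnot : ¬ ρ.SameCycle u (bar u) := by
    rw [hI]
    rcases fin_treeLetter_or htr p with ⟨h1, h2⟩ | ⟨h1, h2⟩ <;> rw [h1, h2]
    · rintro (h | ⟨h, -⟩)
      · exact hne h
      · exact hnp h
    · rintro (h | ⟨-, h⟩)
      · exact hne h.symm
      · exact hnp h
  intro l l'
  rw [hτ, sameCycle_mul_swap_iff hnot, hM, hM, hI, done_append_iff, done_append_iff]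
  constructor
  · rintro ((h | ⟨h1, h2⟩) | ⟨h1, h2⟩)
    · exact Or.inl h
    · exact Or.inr ⟨Or.inl h1, Or.inl h2⟩
    · exact Or.inr ⟨h1, h2⟩
  · rintro (h | ⟨h1, h2⟩)
    · exact Or.inl (Or.inl h)
    · exact Or.inr ⟨h1, h2⟩

/-- **The breadth-first order of the non-base vertices** (non-decreasing distance from the base
point). [cite: ZieschangVogtColdewey1980, 3.1.6] -/
noncomputable def bfsOrder : List (NonBase a₀) :=
  (Finset.univ : Finset (NonBase a₀)).toList.mergeSort fun p q => decide (dist htr p.1 ≤ dist htr q.1)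

omit [Fintype X] [DecidableEq X] in
/-- Every non-base vertex occurs in the breadth-first order. [cite: ZieschangVogtColdewey1980, 3.1.6] -/
theorem mem_bfsOrder (p : NonBase a₀) : p ∈ bfsOrder htr := by
  rw [bfsOrder, mem_mergeSort, Finset.mem_toList]; exact Finset.mem_univ p

omit [Fintype X] [DecidableEq X] in
/-- The breadth-first order has no repetition. [cite: ZieschangVogtColdewey1980, 3.1.6] -/
theorem nodup_bfsOrder : (bfsOrder htr).Nodup :=
  (mergeSort_perm _ _).nodup_iff.2 (Finset.nodup_toList _)

omit [Fintype X] [DecidableEq X] in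
/-- The breadth-first order is sorted by distance. [cite: ZieschangVogtColdewey1980, 3.1.6] -/
theorem pairwise_bfsOrder : (bfsOrder htr).Pairwise fun p q => dist htr p.1 ≤ dist htr q.1 := by
  have h := pairwise_mergeSort (le := fun p q : NonBase a₀ => decide (dist htr p.1 ≤ dist htr q.1))
    (fun a b c hab hbc => by simp only [decide_eq_true_eq] at *; exact hab.trans hbc)
    (fun a b => by simpa [Bool.or_eq_true, decide_eq_true_eq] using le_total _ _)
    (Finset.univ : Finset (NonBase a₀)).toList
  rw [bfsOrder]
  exact h.imp fun {a b} hab => by simpa using hab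

include hR hall htriv hV in
/-- The invariant holds for every prefix of the breadth-first order.
[cite: ZieschangVogtColdewey1980, 3.1.6] -/
theorem contractInv_take : ∀ n, n ≤ (bfsOrder htr).length → ContractInv htr R₀ ((bfsOrder htr).take n)
  | 0, _ => by rw [take_zero]; exact contractInv_nil htr hR hall htriv hV
  | n + 1, hn => by
    have hn' : n < (bfsOrder htr).length := hn
    rw [take_succ_eq_append_getElem hn']
    set p := (bfsOrder htr)[n] with hp
    refine contractInv_snoc htr (contractInv_take n hn'.le) ?_ ?_
    · -- `p` is not among the first `n`
      intro hmem
      obtain ⟨m, hm, hmp⟩ := mem_take_iff_getElem.1 hmem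
      have := (nodup_bfsOrder htr).getElem_inj_iff.1 (hmp.trans hp)
      omega
    · -- the parent of `p` is the base point or comes earlier
      by_cases h0 : parent htr p.1 = a₀
      · exact Or.inl h0
      · right
        set q : NonBase a₀ := ⟨parent htr p.1, h0⟩ with hq
        obtain ⟨m, hm, hmq⟩ := getElem_of_mem (mem_bfsOrder htr q)
        have hlt : m < n := by
          by_contra hge
          push Not at hge
          rcases hge.eq_or_lt with rfl | hgt
          · exact (ne_of_lt (dist_parent_lt htr p.2)).symm (by
              change dist htr p.1 = dist htr q.1
              rw [← hmq, ← hp])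
          · have := (pairwise_iff_getElem.1 (pairwise_bfsOrder htr)) n m hn' hm hgt
            rw [hmq, ← hp] at this
            exact absurd (dist_parent_lt htr p.2) (not_lt.2 this)
        refine ⟨q, ?_, rfl⟩
        rw [← hmq]
        exact mem_take_iff_getElem.2 ⟨m, by omega, rfl⟩

include hR hall htriv hV in
/-- **After contracting all tree edges the twisted vertex permutation is transitive.**
[cite: ZieschangVogtColdewey1980, 3.1.6] -/
theorem sameCycle_contract_all (l l' : (X × A) × Bool) :
    (sysPerm (faces act R₀) * treePerm htr (bfsOrder htr)).SameCycle l l' := by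
  have h := contractInv_take htr hR hall htriv hV (bfsOrder htr).length le_rfl
  rw [take_length] at h
  rw [h]
  right
  have hall' : ∀ b : A, Done (bfsOrder htr) b := fun b => by
    by_cases hb : b = a₀
    · exact Or.inl hb
    · exact Or.inr ⟨⟨b, hb⟩, mem_bfsOrder htr _, rfl⟩
  exact ⟨hall' _, hall' _⟩

end Contract

end CoveringPresentation

end Literature.GroupTheory.CombinatorialGroupTheory
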